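import Summits.Ventures.YMGap.YM3IR.ForestLocality
import Literature.Probability.LatticeModels.DobrushinComparisonMetric

/-!
# YM3IR / ForestQuasiLocality — clause (b)(ii) of `IRConjecture3` HOLDS for the forest block family (kernel proof)

HONEST FRAMING.  This file completes, in the kernel, the «quasi-locality» half of the cell's track-Y4 audit of the one
non-printed hypothesis `IRConjecture3` of the §Y4 sentence (`YM3IR/BalabanSU2.lean`): for the FOREST block family
`forestFamily` (star decimation; `YM3IR/ForestAudit.lean`) the conjunct (ii) of `FluctuationDecouplingAt r ρ W β κ`
(`YM3IR/Statement.lean`) is a THEOREM — for every `β` with `2 ≤ b(β)`, every coarse side, every `κ`, with the constant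
`c = max 2 (2 · sup r)` — because conditioning on a loop-free set of links is disintegration of product Haar along a gauge
forest (`ForestHaar.lean`, `ForestDisintegration.lean`, `ForestLocality.lean`).  NOTHING here is about Yang–Mills dynamics:
no mass gap, no continuum statement, no smallness, no decay estimate; conjunct (i) of the same clause (conditional covariance
DECAY) is NOT addressed (for the forest it is the fine theory's own clustering — cell audit §2.5); and the block MAP concerned
is NOT gauge-covariant (theory-1's `YM3IR/CovariantFamily.lean`), so this says nothing about Bałaban-type covariant block
maps, for which (ii) is a genuine statement about a constrained, loop-carrying conditional law.  It is evidence for the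
cell's honest label (lead R196): as typed, the one conjecture is a reformulation of the target, not a reduction.

CONTENT.
* `leafLink x : Option (Edge 3 M)` — the star link read by the leaf rotation at the fine site `x`
  (`leafGauge_eq_of_leafLink_eq_some`, `leafGauge_congr_off`).
* `weight_gaugeTransform_leafGauge_le` — for a bi-invariant symmetric weight `r` with the triangle inequality, one rotated
  link moves by at most the two leaf rotations at its endpoints; `abs_forestAverage_sub_le` — the OSCILLATION BOUND
  `|Ψ_f(s) − Ψ_f(s')| ≤ Σ_{e ∈ Δf} δf(e) (r(λ_s(e₀), λ_{s'}(e₀)) + r(λ_s(e₁), λ_{s'}(e₁)))` (Föllmer's interpolation bound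
  `DobrushinMetric.abs_sub_le_sum_of_dependsOn` under the integral).
* `forestLoad Δf δf` and `isLipBound_forestAverage` — the forest average is coarse-`r`-Lipschitz with loads charging each star
  link with the fine loads of the links whose endpoint leaves read it; `sum_forestLoad_le : Σ forestLoad ≤ 2 Σ δf`.
* `forest_clause_ii` / `forestFamily_fluctuationDecoupling_ii` — THE PACKAGED CLAUSE: `∃ c, ∀ M ≥ 1, ∀ f Δf δf R, … →
  ∃ h Δh δh, Measurable h ∧ DependsOn h Δh ∧ Δh ⊆ coarseHull Δf R ∧ (∃ C, ∀ V, |h V| ≤ C) ∧ IsLipBound r h δh ∧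
  Σ δh ≤ c Σ δf ∧ |E[f | coarseSigma] − h ∘ blk| ≤ c (Σ δf) e^{−κ R}` a.s. — VERBATIM the (ii)-conjunct of
  `FluctuationDecouplingAt r ρ (forestFamily b hb) β κ` (`R ≥ 1`: `h = Ψ_f`, error `0`; `R = 0`: `h ≡ Ψ_f(1)`).
Hypotheses on `r`: left/right invariance, symmetry, `r a a = 0`, triangle inequality, `r ≤ D` — all satisfied by the
Frobenius distance `suFrobDist` on `SU(N)` of the sentence of record (not instantiated here).

## References
* H. Föllmer, *Random fields and diffusion processes*, École d\'Été de Saint-Flour XV–XVII (1988), Ch. I Remark (2.17)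
  (the interpolation bound; tree `DobrushinComparisonMetric.lean`). [cite: Follmer1988, Ch. I Remark (2.17)]
* M. Creutz, *Quarks, Gluons and Lattices* (1983), eq. (9.19); I. Montvay, G. Münster, *Quantum Fields on a Lattice* (1994),
  §3.2.5 (tree / axial gauge).
-/

noncomputable section

open MeasureTheory
open Literature.MathematicalPhysics.QuantumFieldTheory
open Literature.Probability.LatticeModels.DobrushinMetric

namespace Summit.Ventures.YMGap.YM3IR

section ForestLipschitz

variable {G : Type} [Group G] {b M : ℕ}

/-- `leafLink b M x`: the coarse (star) link read by the leaf rotation at the fine site `x` — `some (blockOf x, i)` if `x` is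
the leaf of its block in direction `i` (then `leafGauge s x = (s (blockOf x, i))⁻¹`), `none` if `x` is not a leaf (then
`leafGauge s x = 1`). [folklore] -/
def leafLink (b M : ℕ) (x : Site 3 (b * M)) : Option (Edge 3 M) := by
  classical
  exact if h : ∃ i : Fin 3, (x i).val % b = 1 ∧ ∀ j, j ≠ i → (x j).val % b = 0
    then some (blockOf b M x, Classical.choose h) else none

/-- At a leaf reading `c`, the leaf rotation is `(s c)⁻¹`. [folklore] -/
theorem leafGauge_eq_of_leafLink_eq_some {s : Edge 3 M → G} {x : Site 3 (b * M)} {c : Edge 3 M}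
    (h : leafLink b M x = some c) : leafGauge b M s x = (s c)⁻¹ := by
  unfold leafLink at h
  unfold leafGauge
  by_cases hx : ∃ i : Fin 3, (x i).val % b = 1 ∧ ∀ j, j ≠ i → (x j).val % b = 0
  · rw [dif_pos hx] at h ⊢
    rw [Option.some.inj h]
  · rw [dif_neg hx] at h
    exact absurd h (by simp)

/-- If two forest fields agree off the coarse link `c` and the site `x` does not read `c`, the leaf rotations at `x` agree.
[folklore] -/
theorem leafGauge_congr_off {s s' : Edge 3 M → G} {c : Edge 3 M} (hss' : ∀ z, z ≠ c → s z = s' z)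
    {x : Site 3 (b * M)} (hx : leafLink b M x ≠ some c) : leafGauge b M s x = leafGauge b M s' x := by
  unfold leafLink at hx
  unfold leafGauge
  by_cases hl : ∃ i : Fin 3, (x i).val % b = 1 ∧ ∀ j, j ≠ i → (x j).val % b = 0
  · rw [dif_pos hl] at hx ⊢
    rw [dif_pos hl, hss' _ (fun heq => hx (by rw [heq]))]
  · rw [dif_neg hl, dif_neg hl]

variable {r : G → G → ℝ}

/-- For a bi-invariant symmetric weight, `r(a⁻¹, b⁻¹) = r(a, b)`. [folklore] -/
theorem weight_inv_inv (hmulL : ∀ g a a' : G, r (g * a) (g * a') = r a a')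
    (hmulR : ∀ g a a' : G, r (a * g) (a' * g) = r a a') (hsymm : ∀ a a' : G, r a a' = r a' a) (a a' : G) :
    r a⁻¹ a'⁻¹ = r a a' := by
  have h1 : r (a * a⁻¹) (a * a'⁻¹) = r a⁻¹ a'⁻¹ := hmulL a a⁻¹ a'⁻¹
  have h2 : r (a * a⁻¹ * a') (a * a'⁻¹ * a') = r (a * a⁻¹) (a * a'⁻¹) := hmulR a' _ _
  rw [← h1, ← h2, mul_inv_cancel, one_mul, inv_mul_cancel_right, hsymm]

/-- **One rotated link moves by at most the two leaf rotations at its endpoints** (bi-invariant symmetric weight with the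
triangle inequality): `r((a^{λ_s})(e), (a^{λ_{s'}})(e)) ≤ r(λ_s(x), λ_{s'}(x)) + r(λ_s(x'), λ_{s'}(x'))`, `x, x'` the endpoints
of `e`. [folklore] -/
theorem weight_gaugeTransform_leafGauge_le (hmulL : ∀ g a a' : G, r (g * a) (g * a') = r a a')
    (hmulR : ∀ g a a' : G, r (a * g) (a' * g) = r a a') (hsymm : ∀ a a' : G, r a a' = r a' a)
    (htri : ∀ a a' a'' : G, r a a'' ≤ r a a' + r a' a'') (s s' : Edge 3 M → G) (a : GaugeConfig 3 (b * M) G)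
    (e : Edge 3 (b * M)) :
    r (gaugeTransform (leafGauge b M s) a e) (gaugeTransform (leafGauge b M s') a e)
      ≤ r (leafGauge b M s e.1) (leafGauge b M s' e.1)
        + r (leafGauge b M s (e.1.shift e.2)) (leafGauge b M s' (e.1.shift e.2)) := by
  set l := leafGauge b M s e.1
  set l' := leafGauge b M s' e.1
  set m := leafGauge b M s (e.1.shift e.2)
  set m' := leafGauge b M s' (e.1.shift e.2)
  show r (l * a e * m⁻¹) (l' * a e * m'⁻¹) ≤ r l l' + r m m'
  calc r (l * a e * m⁻¹) (l' * a e * m'⁻¹)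
      ≤ r (l * a e * m⁻¹) (l' * a e * m⁻¹) + r (l' * a e * m⁻¹) (l' * a e * m'⁻¹) := htri _ _ _
    _ = r l l' + r m⁻¹ m'⁻¹ := by
        congr 1
        · rw [mul_assoc l, mul_assoc l', hmulR]
        · rw [hmulL]
    _ = r l l' + r m m' := by rw [weight_inv_inv hmulL hmulR hsymm]

section Analysis

variable [MeasurableSpace G] {N : ℕ} [TopologicalSpace G] [IsTopologicalGroup G] [BorelSpace G]
  [SecondCountableTopology G]

/-- **OSCILLATION OF THE FOREST AVERAGE IN THE FOREST FIELD.** For a bounded measurable `f` supported in `Δf` with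
coordinatewise Lipschitz loads `δf` (bi-invariant symmetric weight `r` with the triangle inequality) and any probability
law `ν`: `|Ψ_f(s) − Ψ_f(s')| ≤ Σ_{e ∈ Δf} δf(e) · (r(λ_s(e₀), λ_{s'}(e₀)) + r(λ_s(e₁), λ_{s'}(e₁)))` (`e₀, e₁` the endpoints of `e`).
[folklore] -/
theorem abs_forestAverage_sub_le (ν : Measure (GaugeConfig 3 (b * M) G)) [IsProbabilityMeasure ν]
    (hmulL : ∀ g a a' : G, r (g * a) (g * a') = r a a') (hmulR : ∀ g a a' : G, r (a * g) (a' * g) = r a a')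
    (hsymm : ∀ a a' : G, r a a' = r a' a) (htri : ∀ a a' a'' : G, r a a'' ≤ r a a' + r a' a'')
    {f : GaugeConfig 3 (b * M) G → ℝ} (hfm : Measurable f) {C : ℝ} (hC : ∀ U, |f U| ≤ C)
    {Δf : Finset (Edge 3 (b * M))} (hdep : DependsOn f (↑Δf : Set (Edge 3 (b * M))))
    {δf : Edge 3 (b * M) → ℝ} (hδ : IsLipBound r f δf) (s s' : Edge 3 M → G) :
    |forestAverage b M ν f s - forestAverage b M ν f s'|
      ≤ ∑ e ∈ Δf, δf e * (r (leafGauge b M s e.1) (leafGauge b M s' e.1)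
          + r (leafGauge b M s (e.1.shift e.2)) (leafGauge b M s' (e.1.shift e.2))) := by
  classical
  set K := ∑ e ∈ Δf, δf e * (r (leafGauge b M s e.1) (leafGauge b M s' e.1)
          + r (leafGauge b M s (e.1.shift e.2)) (leafGauge b M s' (e.1.shift e.2))) with hK
  have hT : ∀ t : Edge 3 M → G, Measurable (fun a : GaugeConfig 3 (b * M) G => gaugeTransform (leafGauge b M t) a) :=
    fun t => measurable_gaugeTransform_leafGauge.comp (measurable_id.prodMk measurable_const)
  have hint : ∀ t : Edge 3 M → G, Integrable (fun a => f (gaugeTransform (leafGauge b M t) a)) ν := fun t =>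
    Integrable.of_bound (hfm.comp (hT t)).aestronglyMeasurable C
      (Filter.Eventually.of_forall fun a => by rw [Real.norm_eq_abs]; exact hC _)
  have hpt : ∀ a, |f (gaugeTransform (leafGauge b M s) a) - f (gaugeTransform (leafGauge b M s') a)| ≤ K := fun a =>
    (abs_sub_le_sum_of_dependsOn hdep hδ _ _).trans (Finset.sum_le_sum fun e _ =>
      mul_le_mul_of_nonneg_left (weight_gaugeTransform_leafGauge_le hmulL hmulR hsymm htri s s' a e) (hδ.nonneg e))
  unfold forestAverage
  rw [← integral_sub (hint s) (hint s')]
  have h := norm_integral_le_of_norm_le_const (μ := ν) (C := K)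
    (f := fun a => f (gaugeTransform (leafGauge b M s) a) - f (gaugeTransform (leafGauge b M s') a))
    (Filter.Eventually.of_forall fun a => by rw [Real.norm_eq_abs]; exact hpt a)
  simpa [Real.norm_eq_abs] using h

/-- The COARSE LIPSCHITZ LOADS of the forest average: the star link `c` carries the loads `δf(e)` of the fine links `e ∈ Δf`
having an endpoint whose leaf rotation reads `c`. [folklore] -/
def forestLoad (b M : ℕ) (Δf : Finset (Edge 3 (b * M))) (δf : Edge 3 (b * M) → ℝ) (c : Edge 3 M) : ℝ :=
  ∑ e ∈ Δf, δf e * ((if leafLink b M e.1 = some c then 1 else 0) + (if leafLink b M (e.1.shift e.2) = some c then 1 else 0))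

/-- **THE FOREST AVERAGE IS COARSE-LIPSCHITZ** with loads `forestLoad Δf δf` (bi-invariant symmetric weight vanishing on
the diagonal, with the triangle inequality; e.g. the Frobenius distance on `SU(N)`). [folklore] -/
theorem isLipBound_forestAverage (ν : Measure (GaugeConfig 3 (b * M) G)) [IsProbabilityMeasure ν]
    (hmulL : ∀ g a a' : G, r (g * a) (g * a') = r a a') (hmulR : ∀ g a a' : G, r (a * g) (a' * g) = r a a')
    (hsymm : ∀ a a' : G, r a a' = r a' a) (hself : ∀ a : G, r a a = 0)
    (htri : ∀ a a' a'' : G, r a a'' ≤ r a a' + r a' a'')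
    {f : GaugeConfig 3 (b * M) G → ℝ} (hfm : Measurable f) {C : ℝ} (hC : ∀ U, |f U| ≤ C)
    {Δf : Finset (Edge 3 (b * M))} (hdep : DependsOn f (↑Δf : Set (Edge 3 (b * M))))
    {δf : Edge 3 (b * M) → ℝ} (hδ : IsLipBound r f δf) :
    IsLipBound r (forestAverage b M ν f) (forestLoad b M Δf δf) := by
  classical
  have aux : ∀ (c : Edge 3 M) (s s' : Edge 3 M → G), (∀ z, z ≠ c → s z = s' z) → ∀ x : Site 3 (b * M),
      r (leafGauge b M s x) (leafGauge b M s' x) ≤ (if leafLink b M x = some c then 1 else 0) * r (s c) (s' c) := by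
    intro c s s' hss' x
    by_cases hx : leafLink b M x = some c
    · rw [if_pos hx, one_mul, leafGauge_eq_of_leafLink_eq_some hx, leafGauge_eq_of_leafLink_eq_some hx,
        weight_inv_inv hmulL hmulR hsymm]
    · rw [if_neg hx, zero_mul, leafGauge_congr_off hss' hx, hself]
  refine ⟨fun c => Finset.sum_nonneg fun e _ => mul_nonneg (hδ.nonneg e)
    (add_nonneg (by split_ifs <;> norm_num) (by split_ifs <;> norm_num)), fun c s s' hss' => ?_⟩
  refine (abs_forestAverage_sub_le ν hmulL hmulR hsymm htri hfm hC hdep hδ s s').trans ?_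
  unfold forestLoad
  rw [Finset.sum_mul]
  refine Finset.sum_le_sum fun e _ => ?_
  rw [mul_assoc, add_mul]
  exact mul_le_mul_of_nonneg_left (add_le_add (aux c s s' hss' e.1) (aux c s s' hss' (e.1.shift e.2))) (hδ.nonneg e)

end Analysis

/-- Each fine site's leaf rotation reads at most ONE coarse link. [folklore] -/
theorem sum_ite_leafLink_le_one [NeZero M] (x : Site 3 (b * M)) :
    ∑ c : Edge 3 M, (if leafLink b M x = some c then (1 : ℝ) else 0) ≤ 1 := by
  cases hx : leafLink b M x with
  | none => simp
  | some c₀ =>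
    have h : ∀ c : Edge 3 M, (some c₀ = some c) = (c₀ = c) := fun c => propext Option.some_inj
    simp_rw [h]
    rw [Finset.sum_ite_eq Finset.univ c₀]
    simp

/-- **TOTAL COARSE LOAD ≤ 2 × TOTAL FINE LOAD**: every fine link charges at most the two star links read at its endpoints.
[folklore] -/
theorem sum_forestLoad_le [NeZero M] (Δf : Finset (Edge 3 (b * M))) {δf : Edge 3 (b * M) → ℝ}
    (hδ : ∀ e, 0 ≤ δf e) : ∑ c : Edge 3 M, forestLoad b M Δf δf c ≤ 2 * ∑ e ∈ Δf, δf e := by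
  classical
  unfold forestLoad
  rw [Finset.sum_comm, Finset.mul_sum]
  refine Finset.sum_le_sum fun e _ => ?_
  rw [← Finset.mul_sum, Finset.sum_add_distrib]
  calc δf e * ((∑ c : Edge 3 M, if leafLink b M e.1 = some c then (1 : ℝ) else 0)
        + ∑ c : Edge 3 M, if leafLink b M (e.1.shift e.2) = some c then (1 : ℝ) else 0)
      ≤ δf e * (1 + 1) :=
        mul_le_mul_of_nonneg_left (add_le_add (sum_ite_leafLink_le_one e.1) (sum_ite_leafLink_le_one _)) (hδ e)
    _ = 2 * δf e := by rw [mul_add, mul_one, two_mul]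

end ForestLipschitz

section ClauseII

variable {G : Type} [MeasurableSpace G] {N : ℕ} [Group G] [TopologicalSpace G] [IsTopologicalGroup G]
  [BorelSpace G] {b M : ℕ} [SecondCountableTopology G] [NeZero M] [CompactSpace G]

/-- **CLAUSE (b)(ii) OF `IRConjecture3` FOR THE FOREST — COMPLETE, for ONE torus (side `b·M`, `2 ≤ b`).** Under the
Wilson law (every `β`, continuous `ρ`), for every bounded measurable cylinder observable `f` (support `Δf`, coordinatewise
`r`-Lipschitz loads `δf`; `r` a bounded bi-invariant symmetric weight vanishing on the diagonal with the triangle inequality)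
and every `R`: there are `h, Δh, δh` with `h` measurable, `DependsOn h Δh`, `Δh ⊆ coarseHull Δf R`, `h` bounded,
`IsLipBound r h δh`, `Σ δh ≤ c Σ δf` and `|E[f | σ(starDecimation)] − h ∘ starDecimation| ≤ c (Σ δf) e^{−κ R}` a.s., with
`c = max 2 (2 sup r)` and ANY `κ`.  (`R ≥ 1`: `h = Ψ_f`, error `0`, loads `forestLoad`; `R = 0`: `h ≡ Ψ_f(1)`, error
`≤ 2 sup r · Σ δf` by the oscillation bound.)  No smallness, no decay input: disintegration along a gauge forest. [folklore] -/
theorem forest_clause_ii (ρ : G →* Matrix (Fin N) (Fin N) ℂ) (hρ : Continuous ρ) (hb : 2 ≤ b) [NeZero (b * M)] (β : ℝ)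
    {r : G → G → ℝ} (hmulL : ∀ g a a' : G, r (g * a) (g * a') = r a a')
    (hmulR : ∀ g a a' : G, r (a * g) (a' * g) = r a a') (hsymm : ∀ a a' : G, r a a' = r a' a)
    (hself : ∀ a : G, r a a = 0) (htri : ∀ a a' a'' : G, r a a'' ≤ r a a' + r a' a'') {D : ℝ}
    (hD : ∀ a a' : G, r a a' ≤ D) (f : GaugeConfig 3 (b * M) G → ℝ) (Δf : Finset (Edge 3 (b * M)))
    (δf : Edge 3 (b * M) → ℝ) (R : ℕ) (hfm : Measurable f) (hdep : DependsOn f (↑Δf : Set (Edge 3 (b * M))))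
    (hbd : ∃ C, ∀ U, |f U| ≤ C) (hδ : IsLipBound r f δf) (κ : ℝ) :
    ∃ (h : GaugeConfig 3 M G → ℝ) (Δh : Finset (Edge 3 M)) (δh : Edge 3 M → ℝ),
      Measurable h ∧ DependsOn h (↑Δh : Set (Edge 3 M)) ∧ (↑Δh : Set (Edge 3 M)) ⊆ coarseHull b M Δf R ∧
      (∃ C, ∀ V, |h V| ≤ C) ∧ IsLipBound r h δh ∧ (∑ y ∈ Δh, δh y) ≤ max 2 (2 * D) * ∑ x ∈ Δf, δf x ∧
      ∀ᵐ U ∂(wilsonMeasure (d := 3) (L := b * M) ρ β),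
        |condExp (MeasurableSpace.comap (starDecimation (G := G) b M) inferInstance)
            (wilsonMeasure (d := 3) (L := b * M) ρ β) f U - h (starDecimation b M U)|
          ≤ max 2 (2 * D) * (∑ x ∈ Δf, δf x) * Real.exp (-κ * R) := by
  classical
  obtain ⟨C, hC⟩ := hbd
  haveI := isProbabilityMeasure_wilsonMeasure (d := 3) (L := b * M) (G := G) ρ hρ β
  set ν := (wilsonMeasure (d := 3) (L := b * M) ρ β).map (forestFix b M) with hν
  haveI : IsProbabilityMeasure ν :=
    Measure.isProbabilityMeasure_map (measurable_forestFix (G := G) (b := b) (M := M)).aemeasurable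
  have hfi : Integrable f (wilsonMeasure (d := 3) (L := b * M) ρ β) :=
    Integrable.of_bound hfm.aestronglyMeasurable C (Filter.Eventually.of_forall fun U => by
      rw [Real.norm_eq_abs]; exact hC U)
  have hce := condExp_forest_ae_eq_forestAverage ρ hρ hb β hfm hfi
  have hsum : 0 ≤ ∑ x ∈ Δf, δf x := Finset.sum_nonneg fun x _ => hδ.nonneg x
  have hc2 : (2 : ℝ) ≤ max 2 (2 * D) := le_max_left _ _
  have hcD : 2 * D ≤ max 2 (2 * D) := le_max_right _ _
  have hc0 : (0 : ℝ) ≤ max 2 (2 * D) := le_trans (by norm_num) hc2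
  rcases Nat.eq_zero_or_pos R with hR | hR
  · subst hR
    refine ⟨fun _ => forestAverage b M ν f 1, ∅, fun _ => 0, measurable_const, ?_, by simp,
      ⟨C, fun _ => abs_forestAverage_le ν hC 1⟩, ⟨fun _ => le_rfl, fun y σ τ _ => ?_⟩, ?_, ?_⟩
    · rw [Finset.coe_empty]; exact dependsOn_const _
    · rw [sub_self, abs_zero, zero_mul]
    · rw [Finset.sum_empty]; exact mul_nonneg hc0 hsum
    · filter_upwards [hce] with U hU
      rw [hU]
      calc |forestAverage b M ν f (starDecimation b M U) - forestAverage b M ν f 1|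
          ≤ ∑ e ∈ Δf, δf e * (r (leafGauge b M (starDecimation b M U) e.1) (leafGauge b M 1 e.1)
              + r (leafGauge b M (starDecimation b M U) (e.1.shift e.2)) (leafGauge b M 1 (e.1.shift e.2))) :=
            abs_forestAverage_sub_le ν hmulL hmulR hsymm htri hfm hC hdep hδ _ _
        _ ≤ ∑ e ∈ Δf, δf e * (D + D) :=
            Finset.sum_le_sum fun e _ => mul_le_mul_of_nonneg_left (add_le_add (hD _ _) (hD _ _)) (hδ.nonneg e)
        _ = 2 * D * ∑ x ∈ Δf, δf x := by rw [← Finset.sum_mul]; ring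
        _ ≤ max 2 (2 * D) * (∑ x ∈ Δf, δf x) * Real.exp (-κ * ((0 : ℕ) : ℝ)) := by
            rw [Nat.cast_zero, mul_zero, Real.exp_zero, mul_one]
            exact mul_le_mul_of_nonneg_right hcD hsum
  · have hlip := isLipBound_forestAverage ν hmulL hmulR hsymm hself htri hfm hC hdep hδ
    refine ⟨forestAverage b M ν f, (Set.toFinite (endpointStars b M (↑Δf : Set (Edge 3 (b * M))))).toFinset,
      forestLoad b M Δf δf, measurable_forestAverage ν hfm, ?_, ?_, ⟨C, abs_forestAverage_le ν hC⟩, hlip, ?_, ?_⟩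
    · rw [Set.Finite.coe_toFinset]; exact dependsOn_forestAverage ν hdep
    · rw [Set.Finite.coe_toFinset]
      exact (endpointStars_subset_coarseHull (by omega) Δf).trans fun e ⟨x, hx, hxe⟩ => ⟨x, hx, hxe.trans hR⟩
    · calc ∑ y ∈ (Set.toFinite (endpointStars b M (↑Δf : Set (Edge 3 (b * M))))).toFinset, forestLoad b M Δf δf y
          ≤ ∑ y, forestLoad b M Δf δf y := Finset.sum_le_univ_sum_of_nonneg hlip.nonneg
        _ ≤ 2 * ∑ x ∈ Δf, δf x := sum_forestLoad_le Δf hδ.nonneg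
        _ ≤ max 2 (2 * D) * ∑ x ∈ Δf, δf x := mul_le_mul_of_nonneg_right hc2 hsum
    · filter_upwards [hce] with U hU
      rw [hU, sub_self, abs_zero]
      exact mul_nonneg (mul_nonneg hc0 hsum) (Real.exp_nonneg _)

/-- **CLAUSE (b)(ii) OF `FluctuationDecouplingAt` FOR `forestFamily`, VERBATIM** (every coarse side `M ≥ 1`, one constant
`c = max 2 (2 sup r)`, any `κ`): the quasi-locality conjunct of the conjecture `FluctuationDecouplingAt r ρ (forestFamily b hb) β κ`
HOLDS UNCONDITIONALLY whenever `2 ≤ b β` — it is disintegration along a gauge forest, not a renormalisation-group statement.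
(The decay conjunct (b)(i) is NOT addressed here: for the forest it is the fine theory's own clustering transported through the
leaf rotation — cell audit §2.5.) [folklore] -/
theorem forestFamily_fluctuationDecoupling_ii (ρ : G →* Matrix (Fin N) (Fin N) ℂ) (hρ : Continuous ρ)
    {bf : ℝ → ℕ} (hbf : ∀ β, 0 < bf β) (β : ℝ) (h2 : 2 ≤ bf β)
    {r : G → G → ℝ} (hmulL : ∀ g a a' : G, r (g * a) (g * a') = r a a')
    (hmulR : ∀ g a a' : G, r (a * g) (a' * g) = r a a') (hsymm : ∀ a a' : G, r a a' = r a' a)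
    (hself : ∀ a : G, r a a = 0) (htri : ∀ a a' a'' : G, r a a'' ≤ r a a' + r a' a'') {D : ℝ}
    (hD : ∀ a a' : G, r a a' ≤ D) (κ : ℝ) :
    ∃ c : ℝ, ∀ (M : ℕ) [NeZero M],
      ∀ (f : GaugeConfig 3 ((forestFamily (G := G) bf hbf).factor β * M) G → ℝ)
        (Δf : Finset (Edge 3 ((forestFamily (G := G) bf hbf).factor β * M)))
        (δf : Edge 3 ((forestFamily (G := G) bf hbf).factor β * M) → ℝ) (R : ℕ),
      Measurable f → DependsOn f (↑Δf : Set _) → (∃ C, ∀ U, |f U| ≤ C) → IsLipBound r f δf →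
      ∃ (h : GaugeConfig 3 M G → ℝ) (Δh : Finset (Edge 3 M)) (δh : Edge 3 M → ℝ),
        Measurable h ∧ DependsOn h (↑Δh : Set _) ∧ (↑Δh : Set _) ⊆ coarseHull _ _ Δf R ∧
        (∃ C, ∀ V, |h V| ≤ C) ∧ IsLipBound r h δh ∧ (∑ y ∈ Δh, δh y) ≤ c * ∑ x ∈ Δf, δf x ∧
        ∀ᵐ U ∂(fineLaw ρ β (forestFamily bf hbf) M),
          |condExp (coarseSigma (forestFamily bf hbf) β M) (fineLaw ρ β (forestFamily bf hbf) M) f U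
              - h ((forestFamily bf hbf).blk β M U)|
            ≤ c * (∑ x ∈ Δf, δf x) * Real.exp (-κ * R) := by
  refine ⟨max 2 (2 * D), fun M _ f Δf δf R hfm hdep hbd hδ => ?_⟩
  haveI : NeZero (bf β * M) := ⟨Nat.mul_ne_zero (hbf β).ne' (NeZero.ne M)⟩
  exact forest_clause_ii ρ hρ h2 β hmulL hmulR hsymm hself htri hD f Δf δf R hfm hdep hbd hδ κ

end ClauseII

end Summit.Ventures.YMGap.YM3IR

end
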